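import Summits.HodgeConjecture.HodgeConjecture.Theses.SaitoKurokawaBridge
import Literature.AlgebraicGeometry.HodgeTheory.ComplexOrientationDegreeOne
import Literature.AlgebraicGeometry.HodgeTheory.HyperplaneSectionMonodromyProofs
import Literature.AlgebraicGeometry.HodgeTheory.CorrespondenceCupProductIdentities
import Literature.AlgebraicTopology.SingularHomology.UniversalCoefficientsField
import HarnessLib

/-!
# Route `SaitoKurokawaBridge` — support item `SignSymmetricBridgeClassesVanish` (stmt-HodgeConjecture-3277), PROVED

**No-go lemma (C), canonical-carrier form ("sign").** For smooth projective `n`-folds `Y`, `X`, an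
automorphism `σ : Y ≅ Y` over `ℂ`, a class `κ ∈ H²ⁿ((Y ⊗ X)(ℂ); ℂ)` with `(σ ▷ X)^* κ = κ` and `a ∈ Hⁿ(Y(ℂ); ℂ)`
with `σ^* a = -a`: `(κ ∪ fst^* a) ∪ snd^* b = 0` for every `b ∈ Hⁿ(X(ℂ); ℂ)`.

Proof (the printed one).  Pull the triple product `x` back along `φ := σ ▷ X`: `φ ≫ fst = fst ≫ σ`,
`φ ≫ snd = snd` and multiplicativity of pull-back give `φ^* x = -x`.  On the other hand `φ` is an
isomorphism of the smooth projective `2n`-fold `Y ⊗ X`, and **an automorphism acts as the identity on top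
cohomology** (`map_top_eq_self_of_isIso`): `φ(ℂ)_* [(Y ⊗ X)(ℂ)] = [(Y ⊗ X)(ℂ)]` for the complex
orientation family (`map_fundamentalClass_complexOrientationFamily_of_isBirational`, an isomorphism being
birational), every top homology class is a multiple of the fundamental class
(`exists_eq_smul_fundamentalClass`), the Kronecker pairing is natural (`kroneckerPairing_map`) and
separates cohomology classes over a field (`kroneckerPairing_injective_of_field`).  Hence `x = -x`, `x = 0`.
No definition, no named-fact hypothesis, no sorry.

References: [VoisinHodgeI2002] §11.1.2; [HatcherAT2002] §3.1 Thm. 3.2, §3.3 Thm. 3.26;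
[MilnorStasheff1974] §13 p. 151 (holomorphic maps preserve the complex orientation); [Fulton1998] Lemma 19.1.2.
-/

noncomputable section

-- every declaration of this problem lives in `Summit.HodgeConjecture.HodgeConjecture.…` (summit = sub-problem)
set_option linter.dupNamespace false

namespace Summit.HodgeConjecture.HodgeConjecture.Theorems.SignSymmetricBridge

open CategoryTheory MonoidalCategory AlgebraicGeometry
open Literature.AlgebraicGeometry Literature.AlgebraicGeometry.Motives Literature.AlgebraicGeometry.HodgeTheory
open Literature.AlgebraicTopology.SingularHomology

/-- **An automorphism of a smooth projective variety acts as the identity on top cohomology.**  For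
`φ : P ⟶ P` with `φ.left` an isomorphism of schemes (`P` smooth projective of dimension `d`) and
`x ∈ H²ᵈ(P(ℂ); ℂ)`, `φ^* x = x`: `φ(ℂ)_*` fixes the fundamental class of the complex orientation family
(degree `+1` of a birational morphism), top homology is the line of the fundamental class, and the Kronecker
pairing is natural and separating over `ℂ`. [cite: HatcherAT2002, §3.3 Thm. 3.26 and §3.1 Thm. 3.2]
[cite: MilnorStasheff1974, §13 p. 151] [cite: Fulton1998, Lemma 19.1.2] -/
theorem map_top_eq_self_of_isIso {d : ℕ} {P : SchemeOver ℂ} (hP : IsSmoothProjective d P) (φ : P ⟶ P)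
    [IsIso φ.left] {k : ℕ} (hk : 2 * d = k) (x : complexBetti P k) :
    complexBetti.map φ k x = x := by
  subst hk
  have hφ : Resolution.IsBirational φ.left := ⟨⊤, by simp, by simp, inferInstance⟩
  apply kroneckerPairing_injective_of_field ℂ (ComplexPoints P) (2 * d)
  refine LinearMap.ext fun z ↦ ?_
  obtain ⟨c, rfl⟩ := exists_eq_smul_fundamentalClass hP (complexOrientationFamily hP) z
  rw [map_smul, map_smul]
  congr 1
  change kroneckerPairing ℂ ℂ (ComplexPoints P) (2 * d)
      (singularCohomology.map ℂ ℂ (AlgPoints.mapContinuous (L := ℂ) φ) (2 * d) x)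
      (complexOrientationFamily hP).fundamentalClass = _
  rw [kroneckerPairing_map, map_fundamentalClass_complexOrientationFamily_of_isBirational hP hP φ hφ]

end Summit.HodgeConjecture.HodgeConjecture.Theorems.SignSymmetricBridge

namespace Summit.HodgeConjecture.HodgeConjecture.Theorems

open CategoryTheory MonoidalCategory AlgebraicGeometry
open Literature.AlgebraicGeometry Literature.AlgebraicGeometry.Motives Literature.AlgebraicGeometry.HodgeTheory
open Literature.AlgebraicTopology.SingularHomology
open Summit.HodgeConjecture.HodgeConjecture.Theses.SaitoKurokawaBridge

/-- **Item stmt-HodgeConjecture-3277 (`SignSymmetricBridgeClassesVanish`, route `SaitoKurokawaBridge`) BY NAME**: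
no-go lemma (C) — a `(σ ▷ X)`-invariant class `κ` on `Y ⊗ X` pairs to zero with `fst^* a ∪ snd^* b` whenever
`σ^* a = -a`: pulling back along the automorphism `σ ▷ X` negates the top-degree triple product, while
every automorphism fixes top cohomology (`SignSymmetricBridge.map_top_eq_self_of_isIso`).  The type is
literally the route decl `Summit.HodgeConjecture.HodgeConjecture.Theses.SaitoKurokawaBridge.SignSymmetricBridgeClassesVanish`.
[cite: VoisinHodgeI2002, §11.1.2] [cite: HatcherAT2002, §3.3 Thm. 3.26] [cite: MilnorStasheff1974, §13 p. 151] -/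
theorem saitoKurokawaBridge_signSymmetricBridgeClassesVanish_proof : SignSymmetricBridgeClassesVanish := by
  intro n Y X hY hX σ κ a b hκ ha
  have hP : IsSmoothProjective (n + n) (Y ⊗ X) := IsSmoothProjective.tensor_holds hY hX
  -- the automorphism `φ = σ ▷ X` of `Y ⊗ X`
  set φ : Y ⊗ X ⟶ Y ⊗ X := σ.hom ▷ X with hφdef
  haveI : IsIso φ := by
    rw [hφdef, ← MonoidalCategory.whiskerRightIso_hom]
    infer_instance
  haveI : IsIso φ.left := by
    change IsIso ((Over.forget _).map φ)
    infer_instance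
  set x := cupProduct (rfl : (2 * n + n) + n = 2 * n + n + n)
    (cupProduct (rfl : 2 * n + n = 2 * n + n) κ (complexBetti.map (SemiCartesianMonoidalCategory.fst Y X) n a))
    (complexBetti.map (SemiCartesianMonoidalCategory.snd Y X) n b) with hxdef
  -- `φ^* x = -x`
  have h1 : complexBetti.map φ (2 * n + n + n) x = -x := by
    rw [hxdef, complexBetti.map_cupProduct, complexBetti.map_cupProduct, hκ,
      ← complexBetti.map_comp_apply', ← complexBetti.map_comp_apply', hφdef,
      CartesianMonoidalCategory.whiskerRight_fst, CartesianMonoidalCategory.whiskerRight_snd,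
      complexBetti.map_comp_apply', ha, map_neg, map_neg, LinearMap.map_neg₂]
  -- `φ^* x = x` (top degree)
  have h2 : complexBetti.map φ (2 * n + n + n) x = x :=
    SignSymmetricBridge.map_top_eq_self_of_isIso hP φ (by ring) x
  -- hence `x = 0`
  have h3 : (2 : ℂ) • x = 0 := by
    rw [two_smul]
    nth_rewrite 2 [← h2]
    rw [h1]
    exact add_neg_cancel x
  exact (smul_eq_zero.mp h3).resolve_left two_ne_zero

end Summit.HodgeConjecture.HodgeConjecture.Theorems

end
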